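import Literature.NumberTheory.DiophantineGeometry.GeneralizedFermatTwoPowerCoefficient
import Literature.NumberTheory.EllipticCurves.SzpiroFreyCurveProofs
import HarnessLib

/-!
# Ribet 1997, *On the equation `a^p + 2^α b^p + c^p = 0`*: the Frey curve of a solution (proofs)

Topic `Literature/NumberTheory/DiophantineGeometry`; sibling *proofs* file (theorems only: no
definition, no named fact, no `sorry`) of `GeneralizedFermatTwoPowerCoefficient`, whose named fact
`ribet1997_twoPowerFermat` is K. Ribet, *On the equation `a^p + 2^α b^p + c^p = 0`*, Acta Arith.
79 (1997) 7–16, Theorem 3, first sentence, in the range `2 ≤ α < p`, `p ≥ 5`.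

## The printed proof (Ribet 1997, §2–§3) and what this file proves of it

Ribet, §3, p. 13: *"Suppose that `a^p + 2^α b^p + c^p = 0` … we multiply `(a, b, c)` by `−1` if
necessary in order to ensure that `a` is congruent to `3 mod 4`. We again form the Frey curve
`E : y² = x (x − A) (x + B)`"* (`A = a^p`, `B = 2^α b^p`, `C = c^p`; in the tree
`Literature.NumberTheory.EllipticCurves.freyCurve A B`, file `EllipticCurves/Szpiro`). *"The
conductor `N_E` of `E` is the product `2^t rad′(ABC)`, for some integer `t` in the set
`{0, 1, 3, 5}` … `ρ : Gal(ℚ̄/ℚ) → GL(2, 𝔽_p)` defined by `E[p]` is irreducible. It is modular of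
level `N_E` … Since `Δ_E` is a perfect `p`th power times a power of `2`, the representation `ρ` is
finite at each prime `l ≠ 2`. The main theorem of [Ribet 1990] thus implies that `ρ` is modular of
level `2^t` … We conclude that `t = 5`, since there are no non-zero cusp forms of weight two on
`Γ₀(8)`. Equivalently, `ord₂ (B) = 1`"* — impossible for `2 ≤ α`.

This file formalizes the **arithmetic of the Frey curve of a normalised solution** (Ribet's §2),
in the tree's vocabulary (`ordMinimalDiscriminant`, `conductorNorm`, `Has…ReductionAt` of
`DiophantineGeometry/{MinimalDiscriminant, Conductor, LocalReduction}`), all PROVED: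

* §2, p. 10, normalisation: `Ribet1997.odd_of_eq`, `Ribet1997.exists_normalized`,
  `Ribet1997.monomials` (`A, B` coprime, `A ≡ −1 (mod 4)`, `4 ∣ B`, `A + B = −C`), and the
  reduction `ribet1997_twoPowerFermat_iff_normalized` of the named fact to normalised solutions;
  the case distinction `Ribet1997.sixteen_dvd_or_odd` on `ord₂ (B) = r + p ord₂ (b)`.
* §2, p. 10 / Serre 1987 (4.1.2): at an odd prime the equation `y² = x (x − A) (x + B)` is minimal
  (`isMinimalAt_freyIntModel_of_ne_two`), `ord_l (Δ_E) = 2 ord_l (AB(A+B))`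
  (`ordMinimalDiscriminant_freyCurve_of_ne_two`; Serre (4.1.9)) and odd primes of `AB(A+B)` are
  multiplicative (`hasMultiplicativeReductionAt_freyCurve_of_ne_two`).
* §2, p. 11, *"`ord_l (Δ_E) ≡ 0 mod p` for all primes `l ≠ 2`"* — the input "finite at `l ≠ 2`" of
  the level-lowering step: `Ribet1997.dvd_ordMinimalDiscriminant_of_ne_two`
  (`ord_l (Δ_E) = 2p (ord_l a + ord_l b + ord_l c)`).
* §2, p. 11, Lemma and Corollary (*"`N_E` is a power of `2` iff `(a, b, c) = (−1, 1, −1)`"*, *"`E`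
  has multiplicative reduction at some prime `q ≠ 2`"*), in the range `α ≥ 2` where the trivial
  solution does not occur: `Ribet1997.exists_odd_prime_dvd`,
  `Ribet1997.exists_hasMultiplicativeReductionAt`.
* §2, p. 11, the `2`-adic exponent `t` (Diamond–Kramer): the semistable cases `t ∈ {0, 1}`
  (`ord₂ (B) ≥ 4`, i.e. `16 ∣ B`) — `isSemistable_freyCurve_of_sixteen_dvd`,
  `conductorNorm_freyCurve_dvd_radical_of_sixteen_dvd` (`N_E ∣ rad (ABC)`),
  `ordMinimalDiscriminant_freyCurve_two_of_sixteen_dvd` (`ord₂ (Δ_E) = 2 ord₂ (ABC) − 8`, Serre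
  (4.1.6)), and for a solution `Ribet1997.isSemistable_of_sixteen_dvd`,
  `Ribet1997.ordMinimalDiscriminant_two_of_sixteen_dvd` (`ord₂ (Δ_E) = 2r + 2p ord₂ (b) − 8`),
  `Ribet1997.dvd_ordMinimalDiscriminant_two_iff_of_sixteen_dvd` (`p ∣ ord₂ (Δ_E) ↔ r = 4`: by
  Serre's (4.1.12)–(4.1.13) the level of `E[p]` is then `2` for `r ≠ 4` and `1` for `r = 4`); and
  the additive case `t = 3` (`ord₂ (B) ∈ {2, 3}`) as far as "additive reduction at `2`, `f₂ ≥ 2`"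
  (`hasAdditiveReductionAt_freyCurve_two`, `Ribet1997.hasAdditiveReductionAt_two`; *"`E` is
  semistable at `2` if and only if `B` is divisible by `16`"*).

NOT proved here (the Galois-theoretic side of §3, p. 13; none of it is in the tree): modularity of
`E` (Ribet's Thm. 5; the tree's unproved `EllipticCurves.ModularForms.exists_isNewformOf`),
Ribet's level-lowering theorem [Ribet 1990] (not catalogued), irreducibility of `E[p]` (Prop. 1:
Mazur, and Diamond–Kramer in the additive case), Tate's criterion "`E[p]` is finite at a
multiplicative `l ≠ p` iff `p ∣ ord_l (Δ_E)`" (to which `dvd_ordMinimalDiscriminant_of_ne_two` is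
the input), and the exact value `t = 3` for `ord₂ (B) ∈ {2, 3}` (Tate's algorithm at `2`). The
alternative road through the tree's named fact `Automorphic.khare_wintenberger` (Serre 1987, §4.2,
proof of Théorème 1, verbatim for the semistable case `16 ∣ B`) needs in addition Serre's (4.1.11)
(weight `2`) and (4.1.12) (level); the vanishing of `S₂(Γ₀(N))` for `N ∣ 8` is available
(`ModularForms.finrank_cuspForm_two_le_genusX0`).

## References

* [Ribet1997] K. A. Ribet, *On the equation `a^p + 2^α b^p + c^p = 0`*, Acta Arith. 79 (1997),
  7–16: §2 (pp. 10–12), §3 (p. 13).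
* [Serre1987] J.-P. Serre, *Sur les représentations modulaires de degré `2` de `Gal(ℚ̄/ℚ)`*, Duke
  Math. J. 54 (1987), §4.1 ((4.1.2), (4.1.6), (4.1.9), (4.1.11)–(4.1.13)), §4.2.
* [DiamondKramer1995] F. Diamond, K. Kramer, *Modularity of a family of elliptic curves*, Math.
  Res. Lett. 2 (1995), 299–304.
* E. Bombieri, W. Gubler, *Heights in Diophantine Geometry* (2006), Example 12.5.10 (the two
  integral models `freyIntModel`, `freyIntModel₂` of `EllipticCurves/SzpiroFreyProofs`).
* [SilvermanAEC2009] J. H. Silverman, *The Arithmetic of Elliptic Curves*, 2nd ed., VII.1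
  Prop. 1.3, VII.5 Prop. 5.1.
-/

noncomputable section

open UniqueFactorizationMonoid IsDedekindDomain WeierstrassCurve Rat.HeightOneSpectrum
open Literature.NumberTheory.EllipticCurves

namespace Literature.NumberTheory.DiophantineGeometry

/-! ### Valuations of integral models: `ord_v (Δ_min) = ord_p (Δ (W₀))` for `W₀` minimal at `v` -/

/-- For an integral Weierstrass equation `W₀` over `ℤ` which is minimal at the place `v` above the
prime `p` (and with `W₀ ⊗ ℚ` elliptic), `ord_v (Δ_min) = ord_p (Δ (W₀))` (Silverman, AEC VII.1,
Prop. 1.3: the minimal discriminant valuation is attained by every minimal equation), with the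
right-hand side written as `padicValInt p (Δ (W₀))`. [cite: SilvermanAEC2009, VII.1 Prop. 1.3] -/
theorem ordMinimalDiscriminant_eq_padicValInt_of_isMinimalAt {W₀ : WeierstrassCurve ℤ}
    {v : HeightOneSpectrum ℤ} [(W₀.baseChange ℚ).IsElliptic]
    (hmin : (W₀.baseChange ℚ).IsMinimalAt v) :
    (W₀.baseChange ℚ).ordMinimalDiscriminant v = padicValInt (natGenerator v) W₀.Δ := by
  haveI : Fact (natGenerator v).Prime := ⟨prime_natGenerator v⟩
  have hΔ0 : W₀.Δ ≠ 0 := Δ_ne_zero_of_isElliptic_baseChange_int W₀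
  have hval := valuation_Δ_eq_of_isMinimalAt_holds v (W₀.baseChange ℚ) hmin
  rw [baseChange_int_Δ] at hval
  have key : ∀ k : ℕ, (natGenerator v : ℤ) ^ k ∣ W₀.Δ ↔
      k ≤ (W₀.baseChange ℚ).ordMinimalDiscriminant v := by
    intro k
    rw [← Rat.valuation_intCast_le_exp_iff v W₀.Δ k, hval, WithZero.exp_le_exp, neg_le_neg_iff,
      Nat.cast_le]
  apply le_antisymm
  · rcases (padicValInt_dvd_iff _ _).mp ((key _).mpr le_rfl) with h | h
    · exact absurd h hΔ0
    · exact h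
  · exact (key _).mp (padicValInt_dvd _)

/-- `ord_p (x ^ n) = n · ord_p (x)` for integers. [folklore] -/
theorem padicValInt_pow (q : ℕ) [Fact q.Prime] (x : ℤ) (n : ℕ) :
    padicValInt q (x ^ n) = n * padicValInt q x := by
  simp [padicValInt, Int.natAbs_pow, padicValNat.pow]

/-- `ord_p (-x) = ord_p (x)`. [folklore] -/
theorem padicValInt_neg (q : ℕ) (x : ℤ) : padicValInt q (-x) = padicValInt q x := by
  simp [padicValInt]

/-! ### The Frey curve at the odd primes (Ribet 1997, §2, p. 10: "the curve `E` is semistable at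
all primes `p ≠ 2`"; p. 11: "`ord_l (Δ_E) ≡ 0 mod p` for all primes `l ≠ 2`") -/

section OddPrimes

variable {A B : ℤ}

/-- At an odd prime the integral equation `y² = x (x − A) (x + B)` (B–G (12.17), `freyIntModel A B`)
of the Frey curve is minimal, for coprime `A, B`: a prime `l ≠ 2` of `AB(A+B)` does not divide
`c₄ = 16 (A² + AB + B²)`, and a prime `l ∤ AB(A+B)`, `l ≠ 2`, does not divide `Δ = 16 (AB(A+B))²`
(Serre, Duke Math. J. 54 (1987), (4.1.2): "cette équation fournit un modèle minimal de `E` en `l`";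
B–G Ex. 12.5.10). [cite: Serre1987, §4.1 (4.1.2)] -/
theorem isMinimalAt_freyIntModel_of_ne_two (hAB : IsCoprime A B) (v : HeightOneSpectrum ℤ)
    (hv : natGenerator v ≠ 2) : ((freyIntModel A B).baseChange ℚ).IsMinimalAt v := by
  set p := natGenerator v with hp
  have hpp : p.Prime := prime_natGenerator v
  have hpint : Prime (p : ℤ) := Nat.prime_iff_prime_int.mp hpp
  by_cases hpm : (p : ℤ) ∣ A * B * (A + B)
  · refine isMinimalAt_baseChange_int_of_not_dvd_c₄ ?_
    rw [← hp, freyIntModel_c₄]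
    intro hc
    rcases hpint.dvd_or_dvd hc with hc | hc
    · exact hv (eq_two_of_dvd_sixteen hpp hc)
    · exact not_dvd_sq_add_mul_add_sq hAB hpp hpm hc
  · refine isMinimalAt_baseChange_int_of_not_pow_dvd_Δ ?_
    rw [← hp, freyIntModel_Δ]
    intro h
    have h1 : (p : ℤ) ∣ 16 * (A * B * (A + B)) ^ 2 := dvd_trans (dvd_pow_self _ (by norm_num)) h
    rcases hpint.dvd_or_dvd h1 with h16 | h2
    · exact hv (eq_two_of_dvd_sixteen hpp h16)
    · exact hpm (hpint.dvd_of_dvd_pow h2)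

/-- **`ord_l (Δ_E) = 2 ord_l (AB(A+B))` at every odd prime `l`** for the Frey curve
`E : y² = x (x − A) (x + B)`, `A, B` coprime, `AB(A+B) ≠ 0` (Serre 1987, (4.1.9):
"`v_l (j_E) = −v_l (Δ) = −2 v_l (ABC)` si `l ≠ 2`"; Ribet 1997, §2, p. 11: "The minimal
discriminant `Δ_E` of `E` may be written `2^u (ABC)²`"). Here `ord_l (Δ_E)` is the tree's
`ordMinimalDiscriminant` at the place `v` above `l = natGenerator v`. [cite: Ribet1997, §2, p. 11]
[cite: Serre1987, §4.1 (4.1.9)] -/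
theorem ordMinimalDiscriminant_freyCurve_of_ne_two (hAB : IsCoprime A B)
    (h0 : A * B * (A + B) ≠ 0) (v : HeightOneSpectrum ℤ) (hv : natGenerator v ≠ 2) :
    (freyCurve A B).ordMinimalDiscriminant v = 2 * padicValInt (natGenerator v) (A * B * (A + B)) := by
  haveI : Fact (natGenerator v).Prime := ⟨prime_natGenerator v⟩
  haveI := isElliptic_freyIntModel h0
  rw [← baseChange_freyIntModel,
    ordMinimalDiscriminant_eq_padicValInt_of_isMinimalAt (isMinimalAt_freyIntModel_of_ne_two hAB v hv),
    freyIntModel_Δ, padicValInt.mul (by norm_num) (pow_ne_zero 2 h0), padicValInt_pow]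
  have h16 : padicValInt (natGenerator v) 16 = 0 :=
    padicValInt.eq_zero_of_not_dvd fun h ↦ hv (eq_two_of_dvd_sixteen (prime_natGenerator v) h)
  rw [h16, zero_add]

/-- At an odd prime `l ∣ AB(A+B)` the Frey curve has multiplicative reduction (`A, B` coprime;
Serre 1987, (4.1.2): "La courbe `E` a mauvaise réduction en `l` si et seulement si `l` divise
`ABC`, et cette mauvaise réduction est alors de type multiplicatif"; Ribet 1997, §2, Corollary,
p. 11). [cite: Serre1987, §4.1 (4.1.2)] [cite: Ribet1997, §2, Corollary p. 11] -/
theorem hasMultiplicativeReductionAt_freyCurve_of_ne_two (hAB : IsCoprime A B)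
    (h0 : A * B * (A + B) ≠ 0) (v : HeightOneSpectrum ℤ) (hv : natGenerator v ≠ 2)
    (hl : (natGenerator v : ℤ) ∣ A * B * (A + B)) :
    (freyCurve A B).HasMultiplicativeReductionAt v := by
  haveI := isElliptic_freyIntModel h0
  have hpp : (natGenerator v).Prime := prime_natGenerator v
  have hpint : Prime (natGenerator v : ℤ) := Nat.prime_iff_prime_int.mp hpp
  rw [← baseChange_freyIntModel]
  refine (hasMultiplicativeReductionAt_iff_of_isMinimalAt
    (isMinimalAt_freyIntModel_of_ne_two hAB v hv)).mpr ⟨?_, ?_⟩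
  · rw [baseChange_int_Δ, Rat.valuation_intCast_lt_one_iff, freyIntModel_Δ]
    exact dvd_mul_of_dvd_right (dvd_pow hl two_ne_zero) _
  · rw [baseChange_int_c₄, Rat.valuation_intCast_eq_one_iff, freyIntModel_c₄]
    intro hc
    rcases hpint.dvd_or_dvd hc with hc | hc
    · exact hv (eq_two_of_dvd_sixteen hpp hc)
    · exact not_dvd_sq_add_mul_add_sq hAB hpp hl hc

end OddPrimes

/-! ### The Frey curve at `2` when `16 ∣ B` (Ribet 1997, §2, p. 11: `t = 0` or `1`, "`E` is a
semistable elliptic curve precisely when `16` divides `B`"; Diamond–Kramer) -/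

section SixteenDvd

variable {A B : ℤ}

/-- `A ≡ −1 (mod 4)` means `4 ∣ A + 1`. [folklore] -/
private theorem four_dvd_add_one (hA : A ≡ -1 [ZMOD 4]) : 4 ∣ A + 1 := by
  have := Int.ModEq.dvd hA.symm
  simpa [sub_neg_eq_add] using this

/-- For `A ≡ −1 (mod 4)` and `16 ∣ B`, `4 ∣ B − A − 1` (the hypothesis of B–G's (12.18)).
[folklore] -/
private theorem four_dvd_sub (hA : A ≡ -1 [ZMOD 4]) (hB : (16 : ℤ) ∣ B) : 4 ∣ B - A - 1 := by
  have : B - A - 1 = B - (A + 1) := by ring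
  rw [this]
  exact dvd_sub (dvd_trans (by norm_num) hB) (four_dvd_add_one hA)

/-- **Semistability when `16 ∣ B`** (Ribet 1997, §2, p. 11: "`E` is semistable at `2` if and only
if `B` is divisible by `16`. Since `E` is in any case semistable away from `2`, `E` is a semistable
elliptic curve precisely when `16` divides `B`" — the "if" direction; Diamond–Kramer 1995): for
`A ≡ −1 (mod 4)`, `16 ∣ B`, `A, B` coprime, `AB(A+B) ≠ 0`, the Frey curve `y² = x (x − A) (x + B)`
is semistable at every prime. The tree's `isSemistable_freyCurve_of_mod_holds` (Serre's
normalisation `32 ∣ B`) uses only `16 ∣ B`; same proof: the equation (12.18) of Bombieri–Gubler,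
`ℚ`-isomorphic to the Frey curve, is minimal with good or multiplicative reduction everywhere.
[cite: Ribet1997, §2, p. 11] -/
theorem isSemistable_freyCurve_of_sixteen_dvd (hAB : IsCoprime A B) (h0 : A * B * (A + B) ≠ 0)
    (hA : A ≡ -1 [ZMOD 4]) (hB : (16 : ℤ) ∣ B) : (freyCurve A B).IsSemistable ℤ := by
  intro v
  have h4 := four_dvd_sub hA hB
  have h16 : 16 ∣ A * B := dvd_mul_of_dvd_right hB _
  haveI := isElliptic_freyCurve h0
  rw [← isSemistableAt_smul_iff_holds v (freyCurve A B)
    (⟨Units.mk0 (2 : ℚ) two_ne_zero, 0, 1, 0⟩ : VariableChange ℚ),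
    smul_freyCurve_eq_baseChange_freyIntModel₂ h4 h16]
  exact isSemistableAt_freyIntModel₂ hAB h0 (four_dvd_add_one hA) hB v

/-- **Conductor when `16 ∣ B`: `N_E ∣ rad (AB(A+B))`** (Ribet 1997, §2, pp. 10–11: "the conductor
`N_E` of `E` has the form `2^t rad′(ABC)` … `t` is … `0` or `1` according as `ord₂ (B)` is … `4`,
or an integer greater than `4`"): for `A ≡ −1 (mod 4)`, `16 ∣ B`, `A, B` coprime, `AB(A+B) ≠ 0`,
every conductor exponent is `≤ 1` and `N_E` divides the radical of `AB(A+B)`. (The conductor is an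
isomorphism invariant, `conductor_smul`, computed on B–G's (12.18), `conductorNorm_freyIntModel₂_dvd`.)
[cite: Ribet1997, §2, pp. 10–11] -/
theorem conductorNorm_freyCurve_dvd_radical_of_sixteen_dvd (hAB : IsCoprime A B)
    (h0 : A * B * (A + B) ≠ 0) (hA : A ≡ -1 [ZMOD 4]) (hB : (16 : ℤ) ∣ B) :
    (freyCurve A B).conductorNorm ℤ ∣ radical (A * B * (A + B)).natAbs := by
  have h4 := four_dvd_sub hA hB
  have h16 : 16 ∣ A * B := dvd_mul_of_dvd_right hB _
  haveI := isElliptic_freyCurve h0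
  have hC := smul_freyCurve_eq_baseChange_freyIntModel₂ h4 h16
  have hinv := conductor_smul ℤ (freyCurve A B) (fun v ↦ ordMinimalDiscriminant_smul_holds v _)
    (fun v ↦ kodairaSymbol_smul_holds _) (⟨Units.mk0 (2 : ℚ) two_ne_zero, 0, 1, 0⟩ : VariableChange ℚ)
  unfold conductorNorm
  rw [← hinv, hC]
  exact conductorNorm_freyIntModel₂_dvd hAB h0 (four_dvd_add_one hA) hB

/-- **`ord₂ (Δ_E) = 2 ord₂ (AB(A+B)) − 8` when `16 ∣ B`** (Ribet 1997, §2, p. 11: "The minimal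
discriminant `Δ_E` of `E` may be written `2^u (ABC)²` … For instance, `u = −8` when `t = 1`";
Serre 1987, (4.1.6): `Δ = 2⁻⁸ A²B²C²`), stated additively in `ℕ`. For `A ≡ −1 (mod 4)`, `16 ∣ B`
(`A, B` coprime, `AB(A+B) ≠ 0`): the minimal equation at `2` is B–G's (12.18) with
`Δ' = (AB/16)² (A+B)²`. [cite: Ribet1997, §2, p. 11] [cite: Serre1987, §4.1 (4.1.6)] -/
theorem ordMinimalDiscriminant_freyCurve_two_of_sixteen_dvd (hAB : IsCoprime A B)
    (h0 : A * B * (A + B) ≠ 0) (hA : A ≡ -1 [ZMOD 4]) (hB : (16 : ℤ) ∣ B)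
    (v : HeightOneSpectrum ℤ) (hv : natGenerator v = 2) :
    (freyCurve A B).ordMinimalDiscriminant v + 8 = 2 * padicValInt 2 (A * B * (A + B)) := by
  haveI : Fact (Nat.Prime 2) := ⟨Nat.prime_two⟩
  have h4 := four_dvd_sub hA hB
  have h16 : 16 ∣ A * B := dvd_mul_of_dvd_right hB _
  haveI := isElliptic_freyCurve h0
  haveI := isElliptic_freyIntModel₂ h0 h4 h16
  have hC := smul_freyCurve_eq_baseChange_freyIntModel₂ h4 h16
  set C : VariableChange ℚ := ⟨Units.mk0 (2 : ℚ) two_ne_zero, 0, 1, 0⟩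
  rw [← ordMinimalDiscriminant_smul_holds v (freyCurve A B) C, hC,
    ordMinimalDiscriminant_eq_padicValInt_of_isMinimalAt
      (isMinimalAt_freyIntModel₂ hAB (four_dvd_add_one hA) hB v), hv, freyIntModel₂_Δ h4 h16]
  obtain ⟨e, he⟩ := h16
  have he' : A * B / 16 = e := by rw [he]; simp
  have hA0 : A ≠ 0 := fun h ↦ h0 (by rw [h]; ring)
  have hB0 : B ≠ 0 := fun h ↦ h0 (by rw [h]; ring)
  have hAB0 : A + B ≠ 0 := fun h ↦ h0 (by rw [h]; ring)
  have he0 : e ≠ 0 := by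
    rintro rfl
    exact mul_ne_zero hA0 hB0 (by rw [he]; ring)
  rw [he', padicValInt.mul (pow_ne_zero 2 he0) (pow_ne_zero 2 hAB0), padicValInt_pow,
    padicValInt_pow, padicValInt.mul (mul_ne_zero hA0 hB0) hAB0, he,
    padicValInt.mul (by norm_num) he0]
  have : padicValInt 2 16 = 4 := by
    rw [show (16 : ℤ) = ((2 ^ 4 : ℕ) : ℤ) by norm_num, padicValInt.of_nat, padicValNat.prime_pow]
  rw [this]
  ring

end SixteenDvd

/-! ### The Frey curve at `2` when `4 ∣ B`, `16 ∤ B` (Ribet 1997, §2, p. 11: `t = 3`, additive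
reduction at `2`) -/

section Additive

variable {A B : ℤ}

/-- **Additive reduction at `2` when `16 ∤ B`** (Ribet 1997, §2, p. 11: "Thus `E` is semistable at
`2` if and only if `B` is divisible by `16`" — the "only if" direction — and Prop. 1, p. 12: "`E`
has additive reduction at `2`"; Diamond–Kramer 1995: `t = 3` for `ord₂ (B) = 2, 3`): for `A` odd,
`B` even with `16 ∤ B`, `A, B` coprime, `AB(A+B) ≠ 0`, the integral equation
`y² = x (x − A) (x + B)` is minimal at `2` (`2¹¹ ∤ Δ = 16 (AB(A+B))²`) with `2 ∣ Δ` and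
`2 ∣ c₄ = 16 (A² + AB + B²)`: additive reduction, so `f₂ ≥ 2`. [cite: Ribet1997, §2, p. 11 and Prop. 1] -/
theorem hasAdditiveReductionAt_freyCurve_two (h0 : A * B * (A + B) ≠ 0) (hA : Odd A) (hB2 : (2 : ℤ) ∣ B) (hB : ¬ (16 : ℤ) ∣ B) (v : HeightOneSpectrum ℤ)
    (hv : natGenerator v = 2) :
    (freyCurve A B).HasAdditiveReductionAt v ∧ 2 ≤ (freyCurve A B).conductorExponent v := by
  haveI := isElliptic_freyIntModel h0
  -- `16 ∤ AB(A+B)`: the odd factors `A`, `A + B` are prime to `2`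
  have h16 : ¬ (16 : ℤ) ∣ A * B * (A + B) := by
    intro h
    apply hB
    have hA2 : ¬ (2 : ℤ) ∣ A := Int.two_dvd_ne_zero.mpr (Int.odd_iff.mp hA)
    have hodd : Odd (A + B) := hA.add_even (even_iff_two_dvd.mpr hB2)
    have hAB2 : ¬ (2 : ℤ) ∣ A + B := Int.two_dvd_ne_zero.mpr (Int.odd_iff.mp hodd)
    have h16A : IsCoprime ((2 : ℤ) ^ 4) A :=
      ((Int.prime_two.coprime_iff_not_dvd).2 hA2).pow_left
    have h16AB : IsCoprime ((2 : ℤ) ^ 4) (A + B) :=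
      ((Int.prime_two.coprime_iff_not_dvd).2 hAB2).pow_left
    have h' : (2 : ℤ) ^ 4 ∣ A * (B * (A + B)) := by rw [← mul_assoc]; exact_mod_cast h
    exact_mod_cast h16AB.dvd_of_dvd_mul_right (h16A.dvd_of_dvd_mul_left h')
  have hmin : ((freyIntModel A B).baseChange ℚ).IsMinimalAt v := by
    refine isMinimalAt_baseChange_int_of_not_pow_dvd_Δ ?_
    rw [hv, freyIntModel_Δ]
    intro h
    have h' : (2 : ℤ) ^ 12 ∣ 16 * (A * B * (A + B)) ^ 2 := by exact_mod_cast h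
    exact not_two_pow_eleven_dvd h0 h16 (dvd_trans (pow_dvd_pow 2 (by norm_num : 11 ≤ 12)) h')
  have hΔ : ((natGenerator v : ℕ) : ℤ) ∣ (freyIntModel A B).Δ := by
    rw [hv, freyIntModel_Δ]
    exact dvd_mul_of_dvd_left (by norm_num) _
  have hc₄ : ((natGenerator v : ℕ) : ℤ) ∣ (freyIntModel A B).c₄ := by
    rw [hv, freyIntModel_c₄]
    exact dvd_mul_of_dvd_left (by norm_num) _
  rw [← baseChange_freyIntModel]
  refine ⟨(hasAdditiveReductionAt_iff_of_isMinimalAt hmin).mpr ⟨?_, ?_⟩,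
    two_le_conductorExponent_of_dvd_Δ_of_dvd_c₄ hmin hΔ hc₄⟩
  · rw [baseChange_int_Δ, Rat.valuation_intCast_lt_one_iff]; exact hΔ
  · rw [baseChange_int_c₄, Rat.valuation_intCast_lt_one_iff]; exact hc₄

end Additive

/-! ### Solutions of `a^p + 2^r b^p + c^p = 0`: normalisation and the Frey curve
(Ribet 1997, §2, p. 10 and §3, p. 12) -/

namespace Ribet1997

variable {p r : ℕ} {a b c : ℤ}

/-- In a solution of `x^p + 2^r y^p + z^p = 0` with `x, z` coprime and `r, p ≥ 1`, the outer
coordinates are odd (Ribet 1997, §2, p. 10: "It is immediate then that `a` and `c` are odd").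
[cite: Ribet1997, §2, p. 10] -/
theorem odd_of_eq (hp : p ≠ 0) (hr : r ≠ 0) (hac : IsCoprime a c)
    (heq : a ^ p + 2 ^ r * b ^ p + c ^ p = 0) : Odd a ∧ Odd c := by
  have h2 : ¬ IsUnit (2 : ℤ) := by rw [Int.isUnit_iff]; norm_num
  have hmid : (2 : ℤ) ∣ 2 ^ r * b ^ p := dvd_mul_of_dvd_left (dvd_pow_self 2 hr) _
  have ha : ¬ (2 : ℤ) ∣ a := by
    intro ha
    have hc : (2 : ℤ) ∣ c ^ p := by
      have : c ^ p = -(a ^ p + 2 ^ r * b ^ p) := by linear_combination heq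
      rw [this, dvd_neg]
      exact dvd_add (dvd_pow ha hp) hmid
    exact h2 (hac.isUnit_of_dvd' ha (Int.prime_two.dvd_of_dvd_pow hc))
  have hc : ¬ (2 : ℤ) ∣ c := by
    intro hc
    have ha' : (2 : ℤ) ∣ a ^ p := by
      have : a ^ p = -(2 ^ r * b ^ p + c ^ p) := by linear_combination heq
      rw [this, dvd_neg]
      exact dvd_add hmid (dvd_pow hc hp)
    exact h2 (hac.isUnit_of_dvd' (Int.prime_two.dvd_of_dvd_pow ha') hc)
  exact ⟨Int.odd_iff.mpr (Int.two_dvd_ne_zero.mp ha), Int.odd_iff.mpr (Int.two_dvd_ne_zero.mp hc)⟩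

/-- **Normalisation** (Ribet 1997, §2, p. 10: "the congruence `a ≡ −1 mod 4` will be satisfied
after possibly multiplying `(a, b, c)` by `−1`. We shall normalize our solutions by imposing this
congruence"; §3, p. 12): for odd `p` and `r ≥ 1`, a nonzero pairwise coprime solution of
`x^p + 2^r y^p + z^p = 0` may be replaced by one with `a ≡ −1 (mod 4)`. [cite: Ribet1997, §2, p. 10] -/
theorem exists_normalized (hp : Odd p) (hr : r ≠ 0) {x y z : ℤ} (h0 : x * y * z ≠ 0)
    (hxy : IsCoprime x y) (hxz : IsCoprime x z) (hyz : IsCoprime y z)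
    (heq : x ^ p + 2 ^ r * y ^ p + z ^ p = 0) :
    ∃ a b c : ℤ, a * b * c ≠ 0 ∧ IsCoprime a b ∧ IsCoprime a c ∧ IsCoprime b c ∧
      a ≡ -1 [ZMOD 4] ∧ a ^ p + 2 ^ r * b ^ p + c ^ p = 0 := by
  have hx : Odd x := (odd_of_eq hp.pos.ne' hr hxz heq).1
  have hx2 : x % 2 = 1 := Int.odd_iff.mp hx
  have hx4 : x % 4 = 1 ∨ x % 4 = 3 := by omega
  rcases hx4 with h1 | h3
  · refine ⟨-x, -y, -z, by simpa using h0, hxy.neg_neg, hxz.neg_neg, hyz.neg_neg, ?_, ?_⟩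
    · change (-x) % 4 = (-1) % 4
      omega
    · rw [hp.neg_pow, hp.neg_pow, hp.neg_pow]
      linear_combination -heq
  · refine ⟨x, y, z, h0, hxy, hxz, hyz, ?_, heq⟩
    change x % 4 = (-1) % 4
    omega

/-- **The monomials `A = a^p`, `B = 2^r b^p`, `C = c^p`** of a normalised solution (Ribet 1997,
§2, p. 10: "the three monomials `A = a^p`, `B = 2^α b^p` and `C = c^p` are relatively prime …
the integer `A` satisfies `A ≡ −1 mod 4`; furthermore, `B` is even"): for odd `p`, `r ≥ 2`,
`a ≡ −1 (mod 4)` and a nonzero pairwise coprime solution, `A` and `B` are coprime,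
`AB(A + B) ≠ 0`, `A ≡ −1 (mod 4)`, `4 ∣ B` and `A + B = −C`. [cite: Ribet1997, §2, p. 10] -/
theorem monomials (hp : Odd p) (hr : 2 ≤ r) (h0 : a * b * c ≠ 0) (hab : IsCoprime a b)
    (hac : IsCoprime a c) (ha : a ≡ -1 [ZMOD 4]) (heq : a ^ p + 2 ^ r * b ^ p + c ^ p = 0) :
    IsCoprime (a ^ p) (2 ^ r * b ^ p) ∧ a ^ p * (2 ^ r * b ^ p) * (a ^ p + 2 ^ r * b ^ p) ≠ 0 ∧
      a ^ p ≡ -1 [ZMOD 4] ∧ (4 : ℤ) ∣ 2 ^ r * b ^ p ∧ a ^ p + 2 ^ r * b ^ p = -c ^ p := by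
  have hp0 : p ≠ 0 := hp.pos.ne'
  simp only [ne_eq, mul_eq_zero, not_or] at h0
  obtain ⟨⟨ha0, hb0⟩, hc0⟩ := h0
  have hodd := (odd_of_eq hp0 (by omega) hac heq).1
  have ha2 : IsCoprime a 2 :=
    ((Int.prime_two.coprime_iff_not_dvd).2 (Int.two_dvd_ne_zero.mpr (Int.odd_iff.mp hodd))).symm
  have hsum : a ^ p + 2 ^ r * b ^ p = -c ^ p := by linear_combination heq
  refine ⟨(ha2.pow.mul_right hab.pow), ?_, ?_, ?_, hsum⟩
  · rw [hsum]
    exact mul_ne_zero (mul_ne_zero (pow_ne_zero _ ha0)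
      (mul_ne_zero (pow_ne_zero _ two_ne_zero) (pow_ne_zero _ hb0))) (neg_ne_zero.mpr (pow_ne_zero _ hc0))
  · have := ha.pow p
    rwa [hp.neg_one_pow] at this
  · exact dvd_mul_of_dvd_left (by
      rw [show (4 : ℤ) = 2 ^ 2 by norm_num]
      exact pow_dvd_pow 2 hr) _

/-- **Reduction of Ribet's Theorem 3 (case `2 ≤ α < p`) to normalised solutions**: the vendored
`ribet1997_twoPowerFermat` is equivalent to the absence of nonzero pairwise coprime solutions with
`a ≡ −1 (mod 4)` (Ribet 1997, §2, p. 10; §3, p. 12: "we multiply `(a, b, c)` by `−1` if necessary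
in order to ensure that `a` is congruent to `3 mod 4`"). [cite: Ribet1997, §3, p. 12] -/
theorem _root_.Literature.NumberTheory.DiophantineGeometry.ribet1997_twoPowerFermat_iff_normalized :
    ribet1997_twoPowerFermat ↔
      ∀ p : ℕ, p.Prime → 5 ≤ p → ∀ r : ℕ, 2 ≤ r → r < p → ∀ a b c : ℤ, a * b * c ≠ 0 →
        IsCoprime a b → IsCoprime a c → IsCoprime b c → a ≡ -1 [ZMOD 4] →
          a ^ p + 2 ^ r * b ^ p + c ^ p ≠ 0 := by
  refine ⟨fun h p hp h5 r h2 hr a b c h0 hab hac hbc _ ↦ h p hp h5 r h2 hr a b c h0 hab hac hbc,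
    fun h p hp h5 r h2 hr x y z h0 hxy hxz hyz heq ↦ ?_⟩
  obtain ⟨a, b, c, h0', hab, hac, hbc, ha, heq'⟩ :=
    exists_normalized (hp.odd_of_ne_two (by omega)) (by omega) h0 hxy hxz hyz heq
  exact h p hp h5 r h2 hr a b c h0' hab hac hbc ha heq'

/-- **The case distinction on `ord₂ (B)`** (Ribet 1997, §2, p. 11: `t` is `5, 3, 3, 0` or `1`
according as `ord₂ (B)` is `1, 2, 3, 4` or `≥ 5`; here `B = 2^r b^p` with `p ≥ 4`, so
`ord₂ (B) = r + p ord₂ (b) ≥ 2`): either `16 ∣ B` (`b` even, or `r ≥ 4`: the semistable case,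
`t ∈ {0, 1}`), or `b` is odd and `r ∈ {2, 3}` (additive reduction at `2`, `t = 3`).
[cite: Ribet1997, §2, p. 11] -/
theorem sixteen_dvd_or_odd (hp : 4 ≤ p) (b : ℤ) :
    (16 : ℤ) ∣ 2 ^ r * b ^ p ∨ (Odd b ∧ r ≤ 3) := by
  rcases Int.even_or_odd b with hb | hb
  · left
    refine dvd_mul_of_dvd_right ?_ _
    have h2 : (2 : ℤ) ∣ b := even_iff_two_dvd.mp hb
    calc (16 : ℤ) = 2 ^ 4 := by norm_num
      _ ∣ 2 ^ p := pow_dvd_pow 2 hp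
      _ ∣ b ^ p := pow_dvd_pow_of_dvd h2 p
  · rcases le_or_gt r 3 with h3 | h4
    · exact Or.inr ⟨hb, h3⟩
    · left
      refine dvd_mul_of_dvd_left ?_ _
      calc (16 : ℤ) = 2 ^ 4 := by norm_num
        _ ∣ 2 ^ r := pow_dvd_pow 2 h4

/-! #### The Frey curve `E : y² = x (x − a^p) (x + 2^r b^p)` of a normalised solution -/

/-- For an odd prime `q` (the prime below a place `v` of `ℤ`), `ord_q (2) = 0`. [folklore] -/
private theorem padicValInt_two_eq_zero (v : HeightOneSpectrum ℤ) (hv : natGenerator v ≠ 2) :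
    padicValInt (natGenerator v) 2 = 0 := by
  refine padicValInt.eq_zero_of_not_dvd fun h ↦ hv ?_
  have hpp := prime_natGenerator v
  have h2 : (natGenerator v : ℤ) ∣ ((2 : ℕ) : ℤ) := by exact_mod_cast h
  exact (Nat.prime_dvd_prime_iff_eq hpp Nat.prime_two).mp (Int.natCast_dvd_natCast.mp h2)

/-- **`ord_l (Δ_E) ≡ 0 (mod p)` for every odd prime `l`** (Ribet 1997, §2, p. 11: "The minimal
discriminant `Δ_E` of `E` may be written `2^u (ABC)²` … Therefore `ord_l (Δ_E) ≡ 0 mod p` for all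
primes `l ≠ 2`"; Serre 1987, §4.2: "`v_l (ABC) ≡ 0 (mod p)` pour tout `l` premier"), for the Frey
curve `y² = x (x − a^p) (x + 2^r b^p)` of a normalised solution (`p` odd, `r ≥ 2`): indeed
`ord_l (Δ_E) = 2 p (ord_l a + ord_l b + ord_l c)`. This is the input "`ρ` is finite at each prime
`l ≠ 2`" of Ribet's proof of Thm. 3 (§3, p. 13). [cite: Ribet1997, §2, p. 11] -/
theorem dvd_ordMinimalDiscriminant_of_ne_two (hp : Odd p) (hr : 2 ≤ r) (h0 : a * b * c ≠ 0)
    (hab : IsCoprime a b) (hac : IsCoprime a c) (ha : a ≡ -1 [ZMOD 4])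
    (heq : a ^ p + 2 ^ r * b ^ p + c ^ p = 0) (v : HeightOneSpectrum ℤ) (hv : natGenerator v ≠ 2) :
    (freyCurve (a ^ p) (2 ^ r * b ^ p)).ordMinimalDiscriminant v =
        2 * p * (padicValInt (natGenerator v) a + padicValInt (natGenerator v) b +
          padicValInt (natGenerator v) c) ∧
      p ∣ (freyCurve (a ^ p) (2 ^ r * b ^ p)).ordMinimalDiscriminant v := by
  haveI : Fact (natGenerator v).Prime := ⟨prime_natGenerator v⟩
  obtain ⟨hcop, hne, -, -, hsum⟩ := monomials hp hr h0 hab hac ha heq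
  simp only [ne_eq, mul_eq_zero, not_or] at h0
  obtain ⟨⟨ha0, hb0⟩, hc0⟩ := h0
  have key : (freyCurve (a ^ p) (2 ^ r * b ^ p)).ordMinimalDiscriminant v =
      2 * p * (padicValInt (natGenerator v) a + padicValInt (natGenerator v) b +
        padicValInt (natGenerator v) c) := by
    rw [ordMinimalDiscriminant_freyCurve_of_ne_two hcop hne v hv, hsum,
      padicValInt.mul (mul_ne_zero (pow_ne_zero _ ha0)
        (mul_ne_zero (pow_ne_zero _ two_ne_zero) (pow_ne_zero _ hb0))) (neg_ne_zero.mpr (pow_ne_zero _ hc0)),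
      padicValInt.mul (pow_ne_zero _ ha0) (mul_ne_zero (pow_ne_zero _ two_ne_zero) (pow_ne_zero _ hb0)),
      padicValInt.mul (pow_ne_zero _ two_ne_zero) (pow_ne_zero _ hb0), padicValInt_neg]
    simp only [padicValInt_pow, padicValInt_two_eq_zero v hv]
    ring
  exact ⟨key, key ▸ Dvd.intro (2 * (padicValInt (natGenerator v) a + padicValInt (natGenerator v) b +
    padicValInt (natGenerator v) c)) (by ring)⟩

/-- **Multiplicative reduction at the odd primes of `abc`** (Ribet 1997, §2, p. 10: "the curve
`E` is semistable at all primes `p ≠ 2`"; Corollary, p. 11: "`E` has multiplicative reduction at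
some prime `q ≠ 2`"): an odd prime `q ∣ abc` is a prime of multiplicative reduction of the Frey
curve of a normalised solution. [cite: Ribet1997, §2, pp. 10–11] -/
theorem hasMultiplicativeReductionAt_of_dvd (hp : Odd p) (hr : 2 ≤ r) (h0 : a * b * c ≠ 0)
    (hab : IsCoprime a b) (hac : IsCoprime a c) (ha : a ≡ -1 [ZMOD 4])
    (heq : a ^ p + 2 ^ r * b ^ p + c ^ p = 0) (v : HeightOneSpectrum ℤ) (hv : natGenerator v ≠ 2)
    (hq : (natGenerator v : ℤ) ∣ a * b * c) :
    (freyCurve (a ^ p) (2 ^ r * b ^ p)).HasMultiplicativeReductionAt v := by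
  obtain ⟨hcop, hne, -, -, hsum⟩ := monomials hp hr h0 hab hac ha heq
  have hp0 : p ≠ 0 := hp.pos.ne'
  refine hasMultiplicativeReductionAt_freyCurve_of_ne_two hcop hne v hv ?_
  rw [hsum]
  have hpint : Prime (natGenerator v : ℤ) := Nat.prime_iff_prime_int.mp (prime_natGenerator v)
  rcases hpint.dvd_or_dvd hq with h | h
  · rcases hpint.dvd_or_dvd h with h | h
    · exact dvd_mul_of_dvd_left (dvd_mul_of_dvd_left (dvd_pow h hp0) _) _
    · exact dvd_mul_of_dvd_left (dvd_mul_of_dvd_right (dvd_mul_of_dvd_right (dvd_pow h hp0) _) _) _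
  · exact dvd_mul_of_dvd_right (dvd_neg.mpr (dvd_pow h hp0)) _

/-- **Ribet's Lemma, §2, p. 11, in the range `r ≥ 2`: `ABC` has an odd prime factor** ("The
conductor `N_E` is a power of `2` if and only if `(a, b, c)` is the trivial solution `(−1, 1, −1)`":
the trivial solution has `α = 1`; for `α ≥ 2` Ribet's argument — "`rad′(ABC) = 1` … Since
`a ≡ −1 mod 4`, we have `a = −1`. Similarly, the odd number `c` can only be `±1` … The equation
`−1 + 2^α b^p + (±1) = 0` forces `b = 1`, `α = 1`" — produces an odd prime of `ac`): for `r ≥ 2`,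
`p ≥ 1`, a nonzero solution with `a, c` coprime has an odd prime `q ∣ ac`. [cite: Ribet1997, §2, Lemma p. 11] -/
theorem exists_odd_prime_dvd (hp : p ≠ 0) (hr : 2 ≤ r) (h0 : a * b * c ≠ 0) (hac : IsCoprime a c)
    (heq : a ^ p + 2 ^ r * b ^ p + c ^ p = 0) :
    ∃ q : ℕ, q.Prime ∧ q ≠ 2 ∧ (q : ℤ) ∣ a * c := by
  simp only [ne_eq, mul_eq_zero, not_or] at h0
  obtain ⟨⟨ha0, hb0⟩, hc0⟩ := h0
  obtain ⟨hao, hco⟩ := odd_of_eq hp (by omega) hac heq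
  by_contra H
  push Not at H
  -- an odd integer all of whose odd primes are excluded is `±1`
  have unit : ∀ x : ℤ, x ≠ 0 → Odd x → (∀ q : ℕ, q.Prime → q ≠ 2 → ¬ (q : ℤ) ∣ x) →
      x.natAbs = 1 := by
    intro x hx0 hxo hx
    by_contra h1
    obtain ⟨q, hq, hqx⟩ := Nat.exists_prime_and_dvd h1
    have hqx' : (q : ℤ) ∣ x := Int.natCast_dvd.mpr hqx
    refine hx q hq ?_ hqx'
    rintro rfl
    exact (Int.two_dvd_ne_zero.mpr (Int.odd_iff.mp hxo)) (by exact_mod_cast hqx')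
  have ha1 := unit a ha0 hao fun q hq hq2 h ↦ H q hq hq2 (dvd_mul_of_dvd_left h _)
  have hc1 := unit c hc0 hco fun q hq hq2 h ↦ H q hq hq2 (dvd_mul_of_dvd_right h _)
  -- then `a^p + c^p ∈ {0, ±2}` is divisible by `4`, so it vanishes and `b = 0`
  have h4 : (4 : ℤ) ∣ a ^ p + c ^ p := by
    have : a ^ p + c ^ p = -(2 ^ r * b ^ p) := by linear_combination heq
    rw [this, dvd_neg, show (4 : ℤ) = 2 ^ 2 by norm_num]
    exact dvd_mul_of_dvd_left (pow_dvd_pow 2 hr) _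
  have hpm : ∀ x : ℤ, x.natAbs = 1 → x ^ p = 1 ∨ x ^ p = -1 := by
    intro x hx
    rcases Int.natAbs_eq_iff.mp hx with rfl | rfl
    · exact Or.inl (one_pow p)
    · simpa using neg_one_pow_eq_or ℤ p
  have hsum0 : a ^ p + c ^ p = 0 := by
    rcases hpm a ha1 with h | h <;> rcases hpm c hc1 with h' | h' <;> rw [h, h'] at h4 ⊢ <;> omega
  have : (2 : ℤ) ^ r * b ^ p = 0 := by linear_combination heq - hsum0
  simp [hb0] at this

/-- **Corollary (Ribet 1997, §2, p. 11): the Frey curve of a normalised solution with `r ≥ 2` has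
multiplicative reduction at some odd prime** ("If `(a, b, c)` is not the trivial solution, then
`E` has multiplicative reduction at some prime `q ≠ 2`"). [cite: Ribet1997, §2, Corollary p. 11] -/
theorem exists_hasMultiplicativeReductionAt (hp : Odd p) (hr : 2 ≤ r) (h0 : a * b * c ≠ 0)
    (hab : IsCoprime a b) (hac : IsCoprime a c) (ha : a ≡ -1 [ZMOD 4])
    (heq : a ^ p + 2 ^ r * b ^ p + c ^ p = 0) :
    ∃ v : HeightOneSpectrum ℤ, natGenerator v ≠ 2 ∧
      (freyCurve (a ^ p) (2 ^ r * b ^ p)).HasMultiplicativeReductionAt v := by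
  obtain ⟨q, hq, hq2, hqac⟩ := exists_odd_prime_dvd hp.pos.ne' hr h0 hac heq
  obtain ⟨v, hv⟩ := exists_place ⟨q, hq⟩
  simp only at hv
  refine ⟨v, hv ▸ hq2, hasMultiplicativeReductionAt_of_dvd hp hr h0 hab hac ha heq v (hv ▸ hq2) ?_⟩
  rw [hv]
  rcases (Nat.prime_iff_prime_int.mp hq).dvd_or_dvd hqac with hqa | hqc
  · exact dvd_mul_of_dvd_left (dvd_mul_of_dvd_left hqa _) _
  · exact dvd_mul_of_dvd_right hqc _

/-! #### The case `16 ∣ B` (`b` even, or `r ≥ 4`): a semistable Frey curve (Ribet 1997, §2,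
p. 11, `t ∈ {0, 1}`; this is the situation of Serre 1987, §4.1–4.2) -/

/-- **`16 ∣ B`: the Frey curve is semistable and `N_E ∣ rad (ABC)`** (Ribet 1997, §2, p. 11:
"`E` is a semistable elliptic curve precisely when `16` divides `B`"; pp. 10–11: `N_E = 2^t rad′(ABC)`
with `t ∈ {0, 1}` when `ord₂ (B) ≥ 4`). [cite: Ribet1997, §2, pp. 10–11] -/
theorem isSemistable_of_sixteen_dvd (hp : Odd p) (hr : 2 ≤ r) (h0 : a * b * c ≠ 0)
    (hab : IsCoprime a b) (hac : IsCoprime a c) (ha : a ≡ -1 [ZMOD 4])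
    (heq : a ^ p + 2 ^ r * b ^ p + c ^ p = 0) (h16 : (16 : ℤ) ∣ 2 ^ r * b ^ p) :
    (freyCurve (a ^ p) (2 ^ r * b ^ p)).IsSemistable ℤ ∧
      (freyCurve (a ^ p) (2 ^ r * b ^ p)).conductorNorm ℤ ∣
        radical (a ^ p * (2 ^ r * b ^ p) * (a ^ p + 2 ^ r * b ^ p)).natAbs := by
  obtain ⟨hcop, hne, hA, -, -⟩ := monomials hp hr h0 hab hac ha heq
  exact ⟨isSemistable_freyCurve_of_sixteen_dvd hcop hne hA h16,
    conductorNorm_freyCurve_dvd_radical_of_sixteen_dvd hcop hne hA h16⟩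

/-- **`16 ∣ B`: `ord₂ (Δ_E) = 2 r + 2 p ord₂ (b) − 8`** (Ribet 1997, §2, p. 11: `Δ_E = 2^u (ABC)²`,
"`u = −8` when `t = 1`"; Serre 1987, (4.1.6) and (4.1.13) at `l = 2`), stated additively.
[cite: Ribet1997, §2, p. 11] [cite: Serre1987, §4.1 (4.1.13)] -/
theorem ordMinimalDiscriminant_two_of_sixteen_dvd (hp : Odd p) (hr : 2 ≤ r) (h0 : a * b * c ≠ 0)
    (hab : IsCoprime a b) (hac : IsCoprime a c) (ha : a ≡ -1 [ZMOD 4])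
    (heq : a ^ p + 2 ^ r * b ^ p + c ^ p = 0) (h16 : (16 : ℤ) ∣ 2 ^ r * b ^ p)
    (v : HeightOneSpectrum ℤ) (hv : natGenerator v = 2) :
    (freyCurve (a ^ p) (2 ^ r * b ^ p)).ordMinimalDiscriminant v + 8 =
      2 * r + 2 * p * padicValInt 2 b := by
  haveI : Fact (Nat.Prime 2) := ⟨Nat.prime_two⟩
  obtain ⟨hcop, hne, hA, -, hsum⟩ := monomials hp hr h0 hab hac ha heq
  have hp0 : p ≠ 0 := hp.pos.ne'
  obtain ⟨hao, hco⟩ := odd_of_eq hp0 (by omega) hac heq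
  simp only [ne_eq, mul_eq_zero, not_or] at h0
  obtain ⟨⟨ha0, hb0⟩, hc0⟩ := h0
  rw [ordMinimalDiscriminant_freyCurve_two_of_sixteen_dvd hcop hne hA h16 v hv, hsum,
    padicValInt.mul (mul_ne_zero (pow_ne_zero _ ha0)
      (mul_ne_zero (pow_ne_zero _ two_ne_zero) (pow_ne_zero _ hb0))) (neg_ne_zero.mpr (pow_ne_zero _ hc0)),
    padicValInt.mul (pow_ne_zero _ ha0) (mul_ne_zero (pow_ne_zero _ two_ne_zero) (pow_ne_zero _ hb0)),
    padicValInt.mul (pow_ne_zero _ two_ne_zero) (pow_ne_zero _ hb0), padicValInt_neg]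
  have h22 : padicValInt 2 2 = 1 := padicValInt_self
  simp only [padicValInt_pow, padicValInt.eq_zero_of_not_dvd (Int.two_dvd_ne_zero.mpr (Int.odd_iff.mp hao)),
    padicValInt.eq_zero_of_not_dvd (Int.two_dvd_ne_zero.mpr (Int.odd_iff.mp hco)), h22]
  ring

/-- **`16 ∣ B`: `p ∣ ord₂ (Δ_E)` iff `r = 4`** (`5 ≤ p` prime, `2 ≤ r < p`; Serre 1987, (4.1.13) at
`l = 2`: "`v₂ (ABC) ≢ 4 (mod p)`" is the condition for `2` to divide the level `N (ρ)` of `E[p]`;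
here `v₂ (ABC) = r + p ord₂ (b)`). So in the semistable case the prime `2` survives in Serre's
level exactly when `r ≠ 4`. [cite: Serre1987, §4.1 (4.1.12)–(4.1.13)] -/
theorem dvd_ordMinimalDiscriminant_two_iff_of_sixteen_dvd (hp : p.Prime) (h5 : 5 ≤ p)
    (hr : 2 ≤ r) (hrp : r < p) (h0 : a * b * c ≠ 0) (hab : IsCoprime a b) (hac : IsCoprime a c)
    (ha : a ≡ -1 [ZMOD 4]) (heq : a ^ p + 2 ^ r * b ^ p + c ^ p = 0)
    (h16 : (16 : ℤ) ∣ 2 ^ r * b ^ p) (v : HeightOneSpectrum ℤ) (hv : natGenerator v = 2) :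
    p ∣ (freyCurve (a ^ p) (2 ^ r * b ^ p)).ordMinimalDiscriminant v ↔ r = 4 := by
  have hodd : Odd p := hp.odd_of_ne_two (by omega)
  have key := ordMinimalDiscriminant_two_of_sixteen_dvd hodd hr h0 hab hac ha heq h16 v hv
  set n := (freyCurve (a ^ p) (2 ^ r * b ^ p)).ordMinimalDiscriminant v
  set k := padicValInt 2 b
  constructor
  · rintro ⟨m, hm⟩
    rw [hm] at key
    -- `p m + 8 = 2 r + 2 p k`, so `p ∣ 2 (r - 4)` in `ℤ`
    have keyZ : (p : ℤ) * m + 8 = 2 * r + 2 * p * k := by exact_mod_cast key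
    have hdvd : (p : ℤ) ∣ 2 * ((r : ℤ) - 4) := ⟨m - 2 * k, by linear_combination (-1 : ℤ) * keyZ⟩
    have hpint : Prime (p : ℤ) := Nat.prime_iff_prime_int.mp hp
    rcases hpint.dvd_or_dvd hdvd with h2 | h4
    · have : p ∣ 2 := by exact_mod_cast h2
      have := Nat.le_of_dvd two_pos this
      omega
    · by_contra hr4
      rcases lt_or_gt_of_ne hr4 with hlt | hgt
      · have h := Int.natCast_dvd.mp h4
        interval_cases r
        · have : p ≤ 2 := Nat.le_of_dvd two_pos (by simpa using h)
          omega
        · have : p ≤ 1 := Nat.le_of_dvd one_pos (by simpa using h)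
          omega
      · have hle := Int.le_of_dvd (by omega) h4
        omega
  · rintro rfl
    refine ⟨2 * k, ?_⟩
    have : 2 * p * k = p * (2 * k) := by ring
    omega

/-! #### The case `16 ∤ B` (`b` odd and `r ∈ {2, 3}`): additive reduction at `2` (Ribet 1997, §2,
p. 11, `t = 3`) -/

/-- **`b` odd, `r ≤ 3`: additive reduction at `2` and `f₂ ≥ 2`** (Ribet 1997, §2, p. 11: "`E` is
semistable at `2` if and only if `B` is divisible by `16`"; Diamond–Kramer: `t = 3` for
`ord₂ (B) = 2, 3`). [cite: Ribet1997, §2, p. 11] -/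
theorem hasAdditiveReductionAt_two (hp : Odd p) (hr : 2 ≤ r) (hr3 : r ≤ 3) (h0 : a * b * c ≠ 0)
    (hab : IsCoprime a b) (hac : IsCoprime a c) (ha : a ≡ -1 [ZMOD 4]) (hb : Odd b)
    (heq : a ^ p + 2 ^ r * b ^ p + c ^ p = 0) (v : HeightOneSpectrum ℤ) (hv : natGenerator v = 2) :
    (freyCurve (a ^ p) (2 ^ r * b ^ p)).HasAdditiveReductionAt v ∧
      2 ≤ (freyCurve (a ^ p) (2 ^ r * b ^ p)).conductorExponent v := by
  obtain ⟨-, hne, -, h4, -⟩ := monomials hp hr h0 hab hac ha heq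
  have hp0 : p ≠ 0 := hp.pos.ne'
  obtain ⟨hao, -⟩ := odd_of_eq hp0 (by omega) hac heq
  refine hasAdditiveReductionAt_freyCurve_two hne (hao.pow) (dvd_trans (by norm_num) h4) ?_ v hv
  -- `16 ∤ 2^r b^p` for `b` odd and `r ≤ 3`
  intro h16
  have hb2 : ¬ (2 : ℤ) ∣ b ^ p := fun h ↦
    (Int.two_dvd_ne_zero.mpr (Int.odd_iff.mp hb)) (Int.prime_two.dvd_of_dvd_pow h)
  have hcop : IsCoprime ((2 : ℤ) ^ 4) (b ^ p) := ((Int.prime_two.coprime_iff_not_dvd).2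
    (Int.two_dvd_ne_zero.mpr (Int.odd_iff.mp hb))).pow_left.pow_right
  have h' : (2 : ℤ) ^ 4 ∣ 2 ^ r := hcop.dvd_of_dvd_mul_right (by exact_mod_cast h16)
  have h'' : 2 ^ 4 ∣ 2 ^ r := by exact_mod_cast h'
  have := (Nat.pow_dvd_pow_iff_le_right one_lt_two).mp h''
  omega

end Ribet1997

end Literature.NumberTheory.DiophantineGeometry
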